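import Mathlib
import HarnessLib
import HarnessLib.Audit
import Summits.MatrixMultiplication.Statement
import Literature.Computability.AlgebraicComplexity.MatrixMultiplicationExponent
import HarnessLib.Audit.Status.Attr

/-!
Route: BrentRefutationDepth

DORMANT since 2026-08-22T07:35:04Z (reconciler: no traction for 5.2 d (last activity item-evidence-added at 2026-08-17T02:51:07Z); parked, not closed — `ledger route dormant route-MatrixMultiplication-BrentRefutationDepth --off` to reac) — unstaffed, not closed; items shared with open routes are served there. `ledger route dormant <id> --off` reactivates.

# Route BrentRefutationDepth — refutation depth of Brent systems — NS/SOS certificates for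
R(<n,n,n>) > r, calibrated at (2,6), aimed at 3x3 >= 20 and beyond 3n^2

REFUTATION line (targets ¬MatrixMultiplication; realises idea card brent-refutation-depth, which
absorbed
tracial-positivstellensatz-lower-bounds and brent-certificates-beyond-closure). R(⟨n,n,n⟩) > r iff
the Brent system
B(n,r) — the n⁶ cubic equations Σ_{t<r} a_{t,i} b_{t,j} c_{t,k} = ⟨n,n,n⟩_{ijk} in 3rn² unknowns —
has no complex
solution iff (Hilbert) Σ g_{ijk}·B_{ijk} = 1 for some multipliers g; the least multiplier degree is
the REFUTATION
DEPTH D_NS(n,r) (D_SOS for Positivstellensatz refutations of the realification). X =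
POLYNOMIAL-DEPTH SUPERQUADRATIC
REFUTABILITY: there are δ > 0 and C such that for all large n the Brent system B(n, ⌈n^{2+δ}⌉) has a
Nullstellensatz
refutation with multipliers of total degree ≤ n^C. X is strictly stronger than "R(⟨n,n,n⟩) ≥ n^{2+δ}
eventually"
(generic effective-Nullstellensatz degrees are exponential in rn²) and implies ω(ℂ) ≥ 2+δ, hence
¬(ω(ℂ) = 2).
Lean: `∃ δ : ℝ, 0 < δ ∧ ∃ C : ℕ, ∀ᶠ n : ℕ in Filter.atTop, ∃ g : (Fin n × Fin n) → (Fin n × Fin n) →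
(Fin n × Fin n) → MvPolynomial (Fin 3 × Fin ⌈(n : ℝ) ^ (2 + δ)⌉₊ × (Fin n × Fin n)) ℂ, (∀ i j k, (g
i j k).totalDegree ≤ n ^ C) ∧ (∑ i, ∑ j, ∑ k, g i j k * ((∑ t : Fin ⌈(n : ℝ) ^ (2 + δ)⌉₊,
MvPolynomial.X ((0 : Fin 3), t, i) * MvPolynomial.X ((1 : Fin 3), t, j) * MvPolynomial.X ((2 : Fin
3), t, k)) - MvPolynomial.C (Literature.Computability.AlgebraicComplexity.matMulTensor ℂ n n n i j
k))) = 1`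

## Assembly
Pure logic (checked sorry-free in the folder Sketch.lean): PolyDepthRefutation gives, for all large
n, an NS refutation of
B(n, ⌈n^{2+δ}⌉); RefutationSound turns each into ⌈n^{2+δ}⌉ < R(⟨n,n,n⟩), so (n:ℝ)^{2+δ} ≤ ⌈n^{2+δ}⌉₊
≤ R eventually
(Nat.le_ceil); SuperquadraticGap concludes ¬MatrixMultiplication. The ranked cruxes are the
informative rungs of the
same ladder (depth of (2,6) → 3×3 window → classical bounds in polynomial depth → c > 3 →
superquadratic), not premises.

Rationale: WHY THIS LINE. Every catalogued lower-bound method for ⟨n,n,n⟩ is an equation ON THE TENSOR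
(flattenings, Koszul/Young flattenings,
determinantal equations of σ_r) and is capped linearly in the format
(EfremenkoGargOliveiraWigderson2018 Thm 4.4,
Buczynski2026); Nullstellensatz / Positivstellensatz refutations live on the DECOMPOSITION
variables, are complete
(every true "R > r" has one), and are invariant under the isotropy group GL_n³ ⋊ (Z₃⋊Z₂) × S_r ×
(ℂ*)^{2r} (DeGroote1978),
so Gatermann–Parrilo block-diagonalisation (GatermannParrilo2004) makes fixed-depth certificates a
finite linear /
semidefinite computation; the imported area is algebraic proof complexity (Razborov1998,
Grigoriev2001,
GrochowPitassi2018, arXiv:2305.19320, arXiv:2608.08760). New at filing (this route, NOTES): the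
pigeonhole principle
¬WPHP^{n³}_r is (1,3)-reducible to B(n,r) (put a_t = Σ_J p_{J,t} x_J etc. over the n³ standard
triads), so by Razborov's
theorem every NS/PC refutation of B(n,r) has multiplier degree ≥ r/2 − 2: NS depth is
Θ(r)-from-below, the card's
bounded-depth uniform schema is dead, "polynomial depth" is the honest dial (hence X), and on the
computational side only
SOS (for which PHP is easy and the rank principle is open, arXiv:2608.08760 §1) survives beyond toy
sizes. What the line
adds to route BorderRankLowerBound (whose rank-2 crux it re-wants as rank 5): finite, certifiable
first bits — the depth
of Strassen optimality (2,6), the complex 3×3 window now that R_{𝔽₂}(⟨3,3,3⟩) ≥ 20 is certified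
(arXiv:2603.07280), the
depth of the classical 2n²−1 bound — and a proof-complexity reading of the 3n² wall; negatives index
empty at filing.

RANKED CRUXES. #0 PolyDepthRefutation (target) — X: ∃ δ>0 ∃ C, for all large n the Brent system B(n,
⌈n^{2+δ}⌉) has a Nullstellensatz refutation over ℂ with multipliers of total degree ≤ n^C (unknowns
X(0,t,i)=a_{t,i}, X(1,t,j)=b_{t,j}, X(2,t,k)=c_{t,k}; equations indexed by (i,j,k) ∈ (Fin n × Fin
n)³ against matMulTensor ℂ n n n). (why it might fail: False if ω=2 (B(n,n^{2+δ}) becomes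
satisfiable). Even if ω>2: no lower-bound technique beyond 3n²−o(n²) exists, and NS depth is ≥ r/2−2
(PHP reduction), so certificates are astronomically large objects nobody can search.) [Razborov1998,
arXiv:2305.19320, Landsberg2014, EfremenkoGargOliveiraWigderson2018, Blaser2013]
#2 TwoBySixDepth (crux) — CALIBRATION (card C1): the Brent system B(2,6) (64 cubics, 72 unknowns;
infeasible since R(⟨2,2,2⟩) = 7, Winograd1971 / HopcroftKerr1971) has a Nullstellensatz refutation
over ℂ with multipliers of total degree ≤ 12, i.e. D_NS(2,6) ∈ {6, 9, 12} (torus weights force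
multipliers in the triad monomials a_{t,i}b_{t,j}c_{t,k}, so D_NS ∈ 3ℕ, and D_NS(2,6) ≥ 6 by the
hand computation in NOTES; PHP gives only ≥ 1). Found by exact sparse linear algebra over ℚ/𝔽_p
after S_6 × torus × GL_2³-weight reduction (≈4·10⁶ unknowns at degree 6, ≈5·10⁸ at degree 9 before
reduction); the certificate is the first purely algebraic, kernel-checkable proof of Strassen
optimality. [difficulty: M] (why it might fail: D_NS(2,6) may exceed 12: Winograd/Alder–Strassen
proofs branch on ranks of the u_t, and case analysis multiplies NS degree; and a certificate with
10⁵–10⁷ rational coefficients may exist yet be too large to check in Lean's kernel.) [Winograd1971,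
HopcroftKerr1971, DeGroote1978, AlderStrassen1981, GatermannParrilo2004, arXiv:2305.19320]
#3 ThreeByThreeTwenty (crux) — THE 3×3 WINDOW (card C2): R_ℂ(⟨3,3,3⟩) ≥ 20, i.e. B(3,19) is
infeasible over ℂ (window [19,23]: Blaser2003 lower, Laderman 1976 upper; over 𝔽₂ the bound 20 was
certified in 2026 by an orbit/DP search, arXiv:2603.07280, a method that enumerates subspaces and
does not exist over ℂ). Engine: symmetry-reduced SOS/Positivstellensatz relaxations of the realified
B(3,19) (1026 real unknowns; compact isotropy U(3)³ × S_19 × T^{38}) with exact rounding — NS is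
excluded here since D_NS(3,19) ≥ 8 (PHP bound) puts the linear system beyond 10¹¹ unknowns; failing
a certificate, low-degree pseudo-expectations for B(3,19..22) are recorded as evidence (depth lower
bounds). [deps: TwoBySixDepth] [difficulty: open-problem] (why it might fail: R_ℂ(⟨3,3,3⟩) may be 19
(𝔽₂-rank can exceed ℂ-rank); bR(⟨3,3,3⟩) ≤ 20 (Smirnov) so B(3,r≥20) is border-feasible and even
B(3,19) may carry low-degree SOS pseudo-solutions; symmetry-reduced degree-4/6 SDPs may still be too
large to solve and round exactly.) [Blaser2003, arXiv:2603.07280, ConnerHarperLandsberg2023,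
GatermannParrilo2004, KauersMoosbauerWood2026]
#4 BrockettDobkinDepth (crux) — THE DIAL IS FAITHFUL ON CLASSICAL BOUNDS (card C3, corrected from
bounded to polynomial depth): ∃ C ∀ n ≥ 1, the Brent system B(n, 2n²−2) — infeasible by the
classical bound R(⟨n,n,n⟩) ≥ 2n²−1 (Brockett–Dobkin 1978; Alder–Strassen 1981 for the simple algebra
M_n(ℂ)) — has a Nullstellensatz refutation with multipliers of degree ≤ n^C. Lower frame: degree ≥
n²−3 is forced (PHP reduction), and the flattening bound r ≤ n²−1 has depth ≤ 3n² (Cauchy–Binet on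
an n²-minor). A uniform certificate FAMILY, written once for all n, is the expected proof
("flag-algebra style" uniformity of the card, at the honest depth scale). [deps: TwoBySixDepth]
[difficulty: L] (why it might fail: substitution-method proofs pick generic elements and invert left
multiplications (Alder–Strassen); NS simulation of such branching/inversion steps may cost degree
exponential in the n²−1 substitution rounds (NS does not simulate PC case analysis cheaply).)
[AlderStrassen1981, BurgisserClausenShokrollahi1997, Blaser2013, arXiv:2305.19320, Razborov1998]
#5 FBeatThreeNSquared (crux) — BEYOND THE 3n² WALL (shared verbatim with route BorderRankLowerBound,
its rank-2 crux stmt-MatrixMultiplication-0654; card C3/X_SOS at the honest scale): ∃ c > 3 with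
R(⟨n,n,n⟩) ≥ c·n² for all large n. This route's engine for it: a uniform polynomial-depth NS/SOS
certificate family for B(n, ⌊cn²⌋) (any refutation of B(n,⌊cn²⌋) proves R > ⌊cn²⌋ by
RefutationSound); records R ≥ 3n² − o(n²) (Landsberg2014, Massarenti–Raviolo), bR ≥ 2n² − log₂n − 1
(LandsbergMichalek2018). [deps: BrockettDobkinDepth] [difficulty: open-problem] (why it might fail:
no technique certifies more than 3n²−o(n²) for rank (8n² cap for rank methods, EGOW Thm 4.4, is not
the issue: nothing reaches it); NS certificates there have degree ≥ 1.5n² and no uniform family is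
known even for 2.5n².) [Landsberg2014, LandsbergMichalek2018, EfremenkoGargOliveiraWigderson2018,
Blaser1999, Buczynski2026]
#9 RefutationSound (support) — SOUNDNESS (glue, provable now): for all n r D, an NS refutation of
B(n,r) with multipliers of degree ≤ D implies r < R(⟨n,n,n⟩) (if R ≤ r, pad an optimal decomposition
with zero triads to r terms — the sInf is attained by tensorRank_le_card — and evaluate the identity
Σ g·B = 1 at it: every B_{ijk} vanishes, 0 = 1). [difficulty: provable-now] [Blaser2013,
BurgisserClausenShokrollahi1997]
#9 SuperquadraticGap (support) — GLUE (provable now, shared in spirit with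
BorderRankLowerBound.Assembly): an eventual superquadratic rank lower bound n^{2+δ} ≤ R(⟨n,n,n⟩)
makes every admissible exponent ≥ 2+δ (n^{2+δ} = O(n^β) forces β ≥ 2+δ), so ω(ℂ) = sInf ≥ 2+δ > 2
(nonempty: three_mem_admissibleExponents), hence ¬MatrixMultiplication. [difficulty: provable-now]
[Blaser2013]
#9 NSDepthLowerBound (support) — THE NS FLOOR (new observation; proof = (1,3)-reduction of
¬WPHP^{n³}_r to B(n,r): a_{t,i} ↦ Σ_J p_{J,t}·x_J(i), b ↦ Σ p·y_J, c ↦ Σ p·z_J over the n³ standard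
triads (x_J,y_J,z_J); hole axioms p_{Jt}p_{J't} kill mixed terms, Boolean axioms give p³ = p, pigeon
axioms Σ_t p_{Jt} = 1 give ⟨n,n,n⟩; then Razborov's theorem, KrajicekProofComplexity2019 Thm 16.2.1:
no PC refutation of ¬WPHP^m_n of degree ≤ n/2 over any field): an NS refutation of B(n,r) with
multipliers of degree ≤ D forces r ≤ 2D+5. Consequences: D_NS(3,19) ≥ 8, D_NS(n,cn²) ≥ cn²/2 − 2; no
bounded-depth schema exists. Needs Razborov's degree lower bound as a Literature fact (cite request
filed) or a direct NS-only proof via the pigeon-dance basis. [difficulty: XL] [Razborov1998,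
KrajicekProofComplexity2019, arXiv:2305.19320, arXiv:2608.08760]
#9 NoLinearDepthRefutation (support) — FIRST RUNG OF THE DEPTH LADDER (provable now, hand proof in
NOTES): for r ≥ 3 no Brent system B(n,r) has an NS refutation with multipliers of degree ≤ 5
(project to torus weight 0: multipliers become c_e + Σ λ_{e,(t,e')} a_{t}b_{t}c_{t}-monomials;
cross-slot coefficients force λ_{e,(t',e')} = Λ(e,e') antisymmetric and independent of t' when r ≥
3, contradicting the constant term Σ_{e,e'∈supp} Λ(e,e') = −1). Hence D_NS(n,r) ≥ 6, in particular
for (2,6). [difficulty: M] [Brent1975, DeGroote1978]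
#9 RealThreeByThreeTwenty (support) — SPECIAL CASE / FIRST SOS TARGET (open): the REAL rank
R_ℝ(⟨3,3,3⟩) ≥ 20 — exactly what a Positivstellensatz refutation of the real Brent system B_ℝ(3,19)
(513 real unknowns, half the realified size) certifies; weaker than ThreeByThreeTwenty (R_ℝ ≥ R_ℂ)
and the natural dry run of the SOS engine. [difficulty: open-problem] [Blaser2003, arXiv:2603.07280,
Grigoriev2001]

TWO-LAYER PLAN. Foreseen glued splits (none filed now): TwoBySixDepth ⇐ WeightZeroReduction
(torus-invariant certificates suffice, degree
non-increasing) → SymmetricCertificate (an S_6 × GL_2³-weight-isotypic certificate of degree ≤ 12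
exists) → TwoBySixDepth;
ThreeByThreeTwenty ⇐ RealThreeByThreeTwenty-style SOS certificate for the realification → exact
rounding lemma →
ThreeByThreeTwenty; BrockettDobkinDepth ⇐ FlatteningDepth (r ≤ n²−1 in degree ≤ 3n², Cauchy–Binet) →
SubstitutionStep
(one Alder–Strassen substitution costs +O(n) degree) → BrockettDobkinDepth.

KILL CRITERIA. Any positive route's thesis (ω = 2) refutes PolyDepthRefutation and
FBeatThreeNSquared's big sister at once — close
refuted:PolyDepthRefutation. R_ℂ(⟨3,3,3⟩) = 19 (a 19-term complex scheme) refutes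
ThreeByThreeTwenty: pivot the window
items to B(3,18)-depth, keep the line. TwoBySixDepth refuted (a degree-15 pseudo-expectation for
B(2,6)) together with
BrockettDobkinDepth refuted ⇒ NS depth is the wrong dial: pivot the thesis to SOS depth (definition
request D2) or close
exhausted if SOS degree lower bounds (Grigoriev-style) also appear for B(n, n²−1).

NOT DECOMPOSED YET. The SOS/Positivstellensatz predicates for realified Brent systems (definition
request; until then SOS lives in the
informal text of ThreeByThreeTwenty / RealThreeByThreeTwenty); the symmetry-reduction soundness
lemma (invariant
certificates suffice) and the exact-rounding lemma; depth statements for B(3,20..22) and for border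
rank (approximate
Brent systems over ℂ[ε]); PC (dynamic) depth versus NS depth; any kit computation — requested by
provers on ranks 2–3,
not by this file.

CHEAPEST FALSIFIER. Run the degree-6 and degree-9 linear systems for B(2,6) over 𝔽_p with torus+S_6
reduction (≈10⁶–10⁷ unknowns after
reduction; hours off-box): if neither has a solution and degree 12 is out of reach, TwoBySixDepth is
suspect-false and
the NS side of the line retires to NSDepthLowerBound/BrockettDobkinDepth only. Lookup already done
here: the PHP
reduction (NOTES) kills the card's bounded-depth schema before any compute is spent, and
arXiv:2603.07280 shows the 3×3
bound 20 is at least true over 𝔽₂.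

NUMBERS. R(⟨2,2,2⟩) = bR = 7 (Winograd1971, HopcroftKerr1971, Landsberg 2006). R_ℂ(⟨3,3,3⟩) ∈
[19,23] (Blaser2003; Laderman 1976),
R_{𝔽₂}(⟨3,3,3⟩) ≥ 20 (arXiv:2603.07280, 2026), bR(⟨3,3,3⟩) ∈ [17,20] (ConnerHarperLandsberg2023;
Smirnov). Rank records:
R ≥ 2n²−1 (Brockett–Dobkin 1978), 5n²/2 − 3n (Blaser1999), 3n² − o(n²) (Landsberg2014); bR ≥ 2n² −
log₂n − 1
(LandsbergMichalek2018); rank-method cap 8n², determinantal cap 6n²−4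
(EfremenkoGargOliveiraWigderson2018, Buczynski2026).
Depth: D_NS(n,r) ∈ 3ℕ, ≥ 6 for r ≥ 3 (NOTES), ≥ r/2 − 2 (PHP reduction + Razborov1998: PC degree of
¬WPHP^m_n > n/2,
KrajicekProofComplexity2019 Thm 16.2.1), ≤ 3n² at r = n²−1 (Cauchy–Binet); PHP is SOS-easy (degree
2) so no SOS floor is
known. Sizes: B(2,6): 64 equations, 72 unknowns, 384 triad monomials; B(3,19): 729 equations, 513
unknowns, 13851 triad
monomials. Items at open: 11 (1 target, 4 cruxes, 5 support, 1 assembly).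

DEFINITION REQUESTS. D1 `brentSystem n r : (Fin n × Fin n)³ → MvPolynomial (Fin 3 × Fin r × (Fin n ×
Fin n)) K` and `HasNSRefutation
(S : ι → MvPolynomial σ K) (D : ℕ)` (topic Literature/Computability/AlgebraicComplexity), so later
items stop inlining
the system. D2 `HasSOSRefutation` for a family of real polynomials (Σ SOS + ideal = −1, degree ≤ 2d)
and the
realification of a complex polynomial system (topic Literature/Computability/Complexity next to
ProofComplexity.lean).
Cite facts wanted: Razborov1998 PC-degree bound for ¬WPHP^m_n (KrajicekProofComplexity2019 Thm
16.2.1) as a named fact;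
Blaser2003 R(⟨3,3,3⟩) ≥ 19; Winograd1971 R(⟨2,2,2⟩) = 7.

Novelty: Searches (2026-08-15): `lit search --source s2 "proof complexity tensor rank lower bound polynomial
calculus"` (10: GGPS
arXiv:2305.19320; Wang arXiv:2603.07280; Garlík–Gryaznov–Ren–Tzameret arXiv:2608.08760; rest
off-topic); `--source
zbmath` same query (1 relevant: GGPS); `lit search --hybrid "Nullstellensatz degree pigeonhole
polynomial calculus tensor
rank matrix multiplication lower bound"` (local 5.26M chunks: Landsberg2017, BCS1997,
Michałek–Sturmfels, Krajíček Proof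
Complexity pp.327–341 — PHP/PC degree theory, nothing on Brent systems); `lit galaxy search "Brent
equations" --star pdf`
(2: SAT Competition 2023 proceedings, Kauers "No news on matrix multiplication" — satisfiable side
only); `lit frontier
MatrixMultiplication --since 2020` (30 rows; none on refutations); `lit bridges MatrixMultiplication
--cross any` (row 6
GrochowPitassi2018 IPS is the only proof-complexity bridge); read arXiv:2305.19320 §1–4, §7,
arXiv:2603.07280 §1,
arXiv:2608.08760 §1–2, §5.1; OpenAlex budget exhausted, arXiv API rate-limited, galaxy panama
saturated (logged).
Nearest prior art found: arXiv:2305.19320 (GGPS, CCC 2023: PC/NS/SoS degree of Tensor Isomorphism;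
Rank Principle needs
PC degree ≥ r/2+1 via PHP, Thm 1.5/3.5; Brent equations only in Rem 1.4's algorithm);
arXiv:2603.07280 (Wang 2026:
certified R_{𝔽₂}(⟨3,3,3⟩) ≥ 20 by orbit classification + DP, finite fields only); arXiv:2608.08760
(weak rank principle
lower bounds for PCR_{𝔽₂}/SA; SoS hardness of the algebraic rank principle  [refs: 2305.19320, 2603.07280, 2608.08760, 1905.10192, 2212.01175, Landsberg2017, GrochowPitassi2018, KauersMoosbauerWood2026]

Barriers (technique_class: proof-complexity, sum-of-squares, rank-lower-bound): - technique_class: proof-complexity, sum-of-squares, rank-lower-bound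
- Literature.Barriers.MatrixMultiplication.LinearRankMethodBarrier: outside the class by
construction — NS/SOS refutations are identities in the 3rn² decomposition variables, complete by
Hilbert/Stengle, not ranks of linear images of the tensor; the barrier's caps (8n² rank methods,
6n²−4 determinantal border-rank bounds) do not bound refutation depth. Conceded: every KNOWN
certificate family (flattening via Cauchy–Binet, substitution) re-derives a rank-method bound, and
the PHP floor says depth grows like r, so the evasion is in principle until FBeatThreeNSquared
closes.
- Literature.Barriers.MatrixMultiplication.InfimumNotMinimumBarrier: not this class (limits what one
upper-bound algorithm certifies; the line proves lower bounds instance by instance and X is an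
eventual statement).
- Literature.Barriers.MatrixMultiplication.IrreversibilityBarrier: upper-bound-method barrier
(laser/degeneration irreversibility); not this class.
- Literature.Barriers.MatrixMultiplication.UniversalMethodBarrier: upper-bound-method barrier; not
this class.
- Literature.Barriers.MatrixMultiplication.UnstableTensorBarrier: upper-bound-method barrier (powers
of unstable tensors); not this class.
- Literature.Barriers.MatrixMultiplication.RectangularBarrier: upper-bound-method barrier; not this
class.
- Literature.Barriers.MatrixMultiplication.TricoloredSumFreeBarrier: group-theoretic upper-bound
barrier (with NilpotentGroupBarr

History (route lifecycle, newest last):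
- 2026-08-16T04:10:33Z · AUTO-CRUX (backfill): PolyDepthRefutation — hypotheses of the deciding theorem that nothing in the route derives are cruxes (operator:999:1085951)
- 2026-08-22T07:35:04Z · DORMANT — reconciler: no traction for 5.2 d (last activity item-evidence-added at 2026-08-17T02:51:07Z); parked, not closed — `ledger route dormant route-MatrixMultiplica (operator:999:2271044)

sub-problem: MatrixMultiplication · status: dormant · opened planner-plancard-MatrixMultiplication-MatrixM-f6459c0a-0 2026-08-15T11:41:39Z · rev 1 · ledger route-MatrixMultiplication-BrentRefutationDepth
GENERATED by the gate from the ledger (D-0016/17). Provers cite these decls: `theorem foo : Summit.MatrixMultiplication.MatrixMultiplication.Theses.BrentRefutationDepth.<Decl> := …` in Summits/MatrixMultiplication/MatrixMultiplication/Theorems/<Name>.lean.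
-/

namespace Summit.MatrixMultiplication.MatrixMultiplication.Theses.BrentRefutationDepth

open scoped BigOperators Topology Manifold Classical MeasureTheory ProbabilityTheory Matrix InnerProductSpace ComplexConjugate ContinuousMap
open Filter Set Function TopologicalSpace MeasureTheory

attribute [summit_statement] _root_.MatrixMultiplication

/-- item stmt-MatrixMultiplication-5580 · crux (kind.auto-crux: conjecture-grade) · rank 0 · open · by planner
why it might fail: False if ω=2 (B(n,n^{2+δ}) becomes satisfiable). Even if ω>2: no lower-bound technique beyond 3n²−o(n²) exists, and NS depth is ≥ r/2−2 (PHP reduction), so certificates are astronomically large objects nobody can search.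
sources: Razborov1998, arXiv:2305.19320, Landsberg2014, EfremenkoGargOliveiraWigderson2018, Blaser2013
[target] X: ∃ δ>0 ∃ C, for all large n the Brent system B(n, ⌈n^{2+δ}⌉) has a Nullstellensatz
refutation over ℂ with multipliers of total degree ≤ n^C (unknowns X(0,t,i)=a_{t,i},
X(1,t,j)=b_{t,j}, X(2,t,k)=c_{t,k}; equations indexed by (i,j,k) ∈ (Fin n × Fin n)³ against
matMulTensor ℂ n n n). -/
@[route_item "route-MatrixMultiplication-BrentRefutationDepth", crux]
def PolyDepthRefutation : Prop :=
  ∃ δ : ℝ, 0 < δ ∧ ∃ C : ℕ, ∀ᶠ n : ℕ in Filter.atTop, ∃ g : (Fin n × Fin n) → (Fin n × Fin n) → (Fin n × Fin n) → MvPolynomial (Fin 3 × Fin ⌈(n : ℝ) ^ (2 + δ)⌉₊ × (Fin n × Fin n)) ℂ, (∀ i j k, (g i j k).totalDegree ≤ n ^ C) ∧ (∑ i, ∑ j, ∑ k, g i j k * ((∑ t : Fin ⌈(n : ℝ) ^ (2 + δ)⌉₊, MvPolynomial.X ((0 : Fin 3), t, i) * MvPolynomial.X ((1 : Fin 3), t,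 j) * MvPolynomial.X ((2 : Fin 3), t, k)) - MvPolynomial.C (Literature.Computability.AlgebraicComplexity.matMulTensor ℂ n n n i j k))) = 1

/-- item stmt-MatrixMultiplication-5581 · crux · rank 2 · open · by planner
why it might fail: D_NS(2,6) may exceed 12: Winograd/Alder–Strassen proofs branch on ranks of the u_t, and case analysis multiplies NS degree; and a certificate with 10⁵–10⁷ rational coefficients may exist yet be too large to check in Lean's kernel.
sources: Winograd1971, HopcroftKerr1971, DeGroote1978, AlderStrassen1981, GatermannParrilo2004, arXiv:2305.19320
[crux] CALIBRATION (card C1): the Brent system B(2,6) (64 cubics, 72 unknowns; infeasible since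
R(⟨2,2,2⟩) = 7, Winograd1971 / HopcroftKerr1971) has a Nullstellensatz refutation over ℂ with
multipliers of total degree ≤ 12, i.e. D_NS(2,6) ∈ {6, 9, 12} (torus weights force multipliers in
the triad monomials a_{t,i}b_{t,j}c_{t,k}, so D_NS ∈ 3ℕ, and D_NS(2,6) ≥ 6 by the hand computation
in NOTES; PHP gives only ≥ 1). Found by exact sparse linear algebra over ℚ/𝔽_p after S_6 × torus ×
GL_2³-weight reduction (≈4·10⁶ unknowns at degree 6, ≈5·10⁸ at degree 9 before reduction); the
certificate is the first purely algebraic, kernel-checkable proof of Strassen optimality.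
[difficulty: M] -/
@[route_item "route-MatrixMultiplication-BrentRefutationDepth"]
def TwoBySixDepth : Prop :=
  ∃ g : (Fin 2 × Fin 2) → (Fin 2 × Fin 2) → (Fin 2 × Fin 2) → MvPolynomial (Fin 3 × Fin 6 × (Fin 2 × Fin 2)) ℂ, (∀ i j k, (g i j k).totalDegree ≤ 12) ∧ (∑ i, ∑ j, ∑ k, g i j k * ((∑ t : Fin 6, MvPolynomial.X ((0 : Fin 3), t, i) * MvPolynomial.X ((1 : Fin 3), t, j) * MvPolynomial.X ((2 : Fin 3), t, k)) - MvPolynomial.C (Literature.Computability.AlgebraicComplexity.matMulTensor ℂ 2 2 2 i j k))) = 1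

/-- item stmt-MatrixMultiplication-5582 · crux · rank 3 · open · by planner
why it might fail: R_ℂ(⟨3,3,3⟩) may be 19 (𝔽₂-rank can exceed ℂ-rank); bR(⟨3,3,3⟩) ≤ 20 (Smirnov) so B(3,r≥20) is border-feasible and even B(3,19) may carry low-degree SOS pseudo-solutions; symmetry-reduced degree-4/6 SDPs may still be too large to solve and round exactly.
sources: Blaser2003, arXiv:2603.07280, ConnerHarperLandsberg2023, GatermannParrilo2004, KauersMoosbauerWood2026
[crux] THE 3×3 WINDOW (card C2): R_ℂ(⟨3,3,3⟩) ≥ 20, i.e. B(3,19) is infeasible over ℂ (window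
[19,23]: Blaser2003 lower, Laderman 1976 upper; over 𝔽₂ the bound 20 was certified in 2026 by an
orbit/DP search, arXiv:2603.07280, a method that enumerates subspaces and does not exist over ℂ).
Engine: symmetry-reduced SOS/Positivstellensatz relaxations of the realified B(3,19) (1026 real
unknowns; compact isotropy U(3)³ × S_19 × T^{38}) with exact rounding — NS is excluded here since
D_NS(3,19) ≥ 8 (PHP bound) puts the linear system beyond 10¹¹ unknowns; failing a certificate,
low-degree pseudo-expectations for B(3,19..22) are recorded as evidence (depth lower bounds). [deps:
TwoBySixDepth] [difficulty: open-problem] -/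
@[route_item "route-MatrixMultiplication-BrentRefutationDepth", crux]
def ThreeByThreeTwenty : Prop :=
  20 ≤ Literature.Computability.AlgebraicComplexity.tensorRank (Literature.Computability.AlgebraicComplexity.matMulTensor ℂ 3 3 3)

/-- item stmt-MatrixMultiplication-5583 · crux · rank 4 · open · by planner
why it might fail: substitution-method proofs pick generic elements and invert left multiplications (Alder–Strassen); NS simulation of such branching/inversion steps may cost degree exponential in the n²−1 substitution rounds (NS does not simulate PC case analysis cheaply).
sources: AlderStrassen1981, BurgisserClausenShokrollahi1997, Blaser2013, arXiv:2305.19320, Razborov1998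
[crux] THE DIAL IS FAITHFUL ON CLASSICAL BOUNDS (card C3, corrected from bounded to polynomial
depth): ∃ C ∀ n ≥ 1, the Brent system B(n, 2n²−2) — infeasible by the classical bound R(⟨n,n,n⟩) ≥
2n²−1 (Brockett–Dobkin 1978; Alder–Strassen 1981 for the simple algebra M_n(ℂ)) — has a
Nullstellensatz refutation with multipliers of degree ≤ n^C. Lower frame: degree ≥ n²−3 is forced
(PHP reduction), and the flattening bound r ≤ n²−1 has depth ≤ 3n² (Cauchy–Binet on an n²-minor). A
uniform certificate FAMILY, written once for all n, is the expected proof ("flag-algebra style"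
uniformity of the card, at the honest depth scale). [deps: TwoBySixDepth] [difficulty: L] -/
@[route_item "route-MatrixMultiplication-BrentRefutationDepth"]
def BrockettDobkinDepth : Prop :=
  ∃ C : ℕ, ∀ n : ℕ, 1 ≤ n → ∃ g : (Fin n × Fin n) → (Fin n × Fin n) → (Fin n × Fin n) → MvPolynomial (Fin 3 × Fin (2 * n ^ 2 - 2) × (Fin n × Fin n)) ℂ, (∀ i j k, (g i j k).totalDegree ≤ n ^ C) ∧ (∑ i, ∑ j, ∑ k, g i j k * ((∑ t : Fin (2 * n ^ 2 - 2), MvPolynomial.X ((0 : Fin 3), t, i) * MvPolynomial.X ((1 : Fin 3), t, j) * MvPolynomial.X ((2 : Fin 3), t, k)) - MvPolynomial.C (Literature.Computability.AlgebraicComplexity.matMulTensor ℂ n n n i j k))) = 1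

/-- item stmt-MatrixMultiplication-0654 · crux · rank 5 · open · by planner
why it might fail: no technique certifies more than 3n²−o(n²) for rank (8n² cap for rank methods, EGOW Thm 4.4, is not the issue: nothing reaches it); NS certificates there have degree ≥ 1.5n² and no uniform family is known even for 2.5n².
sources: Landsberg2014, LandsbergMichalek2018, EfremenkoGargOliveiraWigderson2018, Blaser1999, Buczynski2026
Beat the constant 3 in the rank lower bound: ∃ c > 3 such that R(<n,n,n>) ≥ c·n^2 for all
sufficiently large n over ℂ (records: R ≥ 3n^2 − o(n^2), Landsberg 2014 / Massarenti–Raviolo; bR ≥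
2n^2 − log_2 n − 1, LandsbergMichalek2018; rank methods capped at 8n^2,
EfremenkoGargOliveiraWigderson2018 Thm 4.4). -/
@[route_item "route-MatrixMultiplication-BrentRefutationDepth"]
def FBeatThreeNSquared : Prop :=
  ∃ c : ℝ, 3 < c ∧ ∀ᶠ n : ℕ in Filter.atTop, c * (n : ℝ) ^ 2 ≤ (Literature.Computability.AlgebraicComplexity.tensorRank (Literature.Computability.AlgebraicComplexity.matMulTensor ℂ n n n) : ℝ)

/-- item stmt-MatrixMultiplication-5584 · support · rank 9 · closed · proved by Summit.MatrixMultiplication.MatrixMultiplication.Theorems.refutationSound_proof @ f7e5fa294c18 (prover) · by planner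
sources: Blaser2013, BurgisserClausenShokrollahi1997
[support] SOUNDNESS (glue, provable now): for all n r D, an NS refutation of B(n,r) with multipliers
of degree ≤ D implies r < R(⟨n,n,n⟩) (if R ≤ r, pad an optimal decomposition with zero triads to r
terms — the sInf is attained by tensorRank_le_card — and evaluate the identity Σ g·B = 1 at it:
every B_{ijk} vanishes, 0 = 1). [difficulty: provable-now] -/
@[route_item "route-MatrixMultiplication-BrentRefutationDepth", crux]
def RefutationSound : Prop :=
  ∀ n r D : ℕ, (∃ g : (Fin n × Fin n) → (Fin n × Fin n) → (Fin n × Fin n) → MvPolynomial (Fin 3 × Fin r × (Fin n × Fin n)) ℂ, (∀ i j k, (g i j k).totalDegree ≤ D) ∧ (∑ i, ∑ j, ∑ k, g i j k * ((∑ t : Fin r, MvPolynomial.X ((0 : Fin 3), t, i) * MvPolynomial.X ((1 : Fin 3), t, j) * MvPolynomial.X ((2 : Fin 3), t, k)) - MvPolynomial.C (Literature.Computability.AlgebraicComplexity.matMulTensor ℂ n n n i j k))) = 1) → r < Literature.Computability.AlgebraicComplexity.tensorRank (Literature.Computability.AlgebraicComplexity.matMulTensor ℂ n n n)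

/-- item stmt-MatrixMultiplication-5585 · support · rank 9 · closed · proved by Summit.MatrixMultiplication.MatrixMultiplication.Theorems.superquadraticGap_proof @ 0ea98118b10f (prover) · by planner
sources: Blaser2013
[support] GLUE (provable now, shared in spirit with BorderRankLowerBound.Assembly): an eventual
superquadratic rank lower bound n^{2+δ} ≤ R(⟨n,n,n⟩) makes every admissible exponent ≥ 2+δ (n^{2+δ}
= O(n^β) forces β ≥ 2+δ), so ω(ℂ) = sInf ≥ 2+δ > 2 (nonempty: three_mem_admissibleExponents), hence
¬MatrixMultiplication. [difficulty: provable-now] -/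
@[route_item "route-MatrixMultiplication-BrentRefutationDepth", crux]
def SuperquadraticGap : Prop :=
  (∃ δ : ℝ, 0 < δ ∧ ∀ᶠ n : ℕ in Filter.atTop, (n : ℝ) ^ (2 + δ) ≤ (Literature.Computability.AlgebraicComplexity.tensorRank (Literature.Computability.AlgebraicComplexity.matMulTensor ℂ n n n) : ℝ)) → ¬ MatrixMultiplication

/-- item stmt-MatrixMultiplication-5586 · support · rank 9 · closed · proved by Summit.MatrixMultiplication.MatrixMultiplication.Theorems.NSDepthLowerBound_proof @ 141c5e4fb5a7 (prover) · by planner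
sources: Razborov1998, KrajicekProofComplexity2019, arXiv:2305.19320, arXiv:2608.08760
[support] THE NS FLOOR (new observation; proof = (1,3)-reduction of ¬WPHP^{n³}_r to B(n,r): a_{t,i}
↦ Σ_J p_{J,t}·x_J(i), b ↦ Σ p·y_J, c ↦ Σ p·z_J over the n³ standard triads (x_J,y_J,z_J); hole
axioms p_{Jt}p_{J't} kill mixed terms, Boolean axioms give p³ = p, pigeon axioms Σ_t p_{Jt} = 1 give
⟨n,n,n⟩; then Razborov's theorem, KrajicekProofComplexity2019 Thm 16.2.1: no PC refutation of
¬WPHP^m_n of degree ≤ n/2 over any field): an NS refutation of B(n,r) with multipliers of degree ≤ D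
forces r ≤ 2D+5. Consequences: D_NS(3,19) ≥ 8, D_NS(n,cn²) ≥ cn²/2 − 2; no bounded-depth schema
exists. Needs Razborov's degree lower bound as a Literature fact (cite request filed) or a direct
NS-only proof via the pigeon-dance basis. [difficulty: XL] -/
@[route_item "route-MatrixMultiplication-BrentRefutationDepth"]
def NSDepthLowerBound : Prop :=
  ∀ n r D : ℕ, (∃ g : (Fin n × Fin n) → (Fin n × Fin n) → (Fin n × Fin n) → MvPolynomial (Fin 3 × Fin r × (Fin n × Fin n)) ℂ, (∀ i j k, (g i j k).totalDegree ≤ D) ∧ (∑ i, ∑ j, ∑ k, g i j k * ((∑ t : Fin r, MvPolynomial.X ((0 : Fin 3), t, i) * MvPolynomial.X ((1 : Fin 3), t, j) * MvPolynomial.X ((2 : Fin 3), t, k)) - MvPolynomial.C (Literature.Computability.AlgebraicComplexity.matMulTensor ℂ n n n i j k))) = 1) → r ≤ 2 * D + 5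

/-- item stmt-MatrixMultiplication-5587 · support · rank 9 · closed · proved by Summit.MatrixMultiplication.MatrixMultiplication.Theorems.noLinearDepthRefutation_proof @ 6d597943b774 (prover) · by planner
sources: Brent1975, DeGroote1978
[support] FIRST RUNG OF THE DEPTH LADDER (provable now, hand proof in NOTES): for r ≥ 3 no Brent
system B(n,r) has an NS refutation with multipliers of degree ≤ 5 (project to torus weight 0:
multipliers become c_e + Σ λ_{e,(t,e')} a_{t}b_{t}c_{t}-monomials; cross-slot coefficients force
λ_{e,(t',e')} = Λ(e,e') antisymmetric and independent of t' when r ≥ 3, contradicting the constant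
term Σ_{e,e'∈supp} Λ(e,e') = −1). Hence D_NS(n,r) ≥ 6, in particular for (2,6). [difficulty: M] -/
@[route_item "route-MatrixMultiplication-BrentRefutationDepth"]
def NoLinearDepthRefutation : Prop :=
  ∀ n r : ℕ, 3 ≤ r → ¬ ∃ g : (Fin n × Fin n) → (Fin n × Fin n) → (Fin n × Fin n) → MvPolynomial (Fin 3 × Fin r × (Fin n × Fin n)) ℂ, (∀ i j k, (g i j k).totalDegree ≤ 5) ∧ (∑ i, ∑ j, ∑ k, g i j k * ((∑ t : Fin r, MvPolynomial.X ((0 : Fin 3), t, i) * MvPolynomial.X ((1 : Fin 3), t, j) * MvPolynomial.X ((2 : Fin 3), t, k)) - MvPolynomial.C (Literature.Computability.AlgebraicComplexity.matMulTensor ℂ n n n i j k))) = 1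

/-- item stmt-MatrixMultiplication-5588 · support · rank 9 · open · by planner
sources: Blaser2003, arXiv:2603.07280, Grigoriev2001
[support] SPECIAL CASE / FIRST SOS TARGET (open): the REAL rank R_ℝ(⟨3,3,3⟩) ≥ 20 — exactly what a
Positivstellensatz refutation of the real Brent system B_ℝ(3,19) (513 real unknowns, half the
realified size) certifies; weaker than ThreeByThreeTwenty (R_ℝ ≥ R_ℂ) and the natural dry run of the
SOS engine. [difficulty: open-problem] -/
@[route_item "route-MatrixMultiplication-BrentRefutationDepth"]
def RealThreeByThreeTwenty : Prop :=
  20 ≤ Literature.Computability.AlgebraicComplexity.tensorRank (Literature.Computability.AlgebraicComplexity.matMulTensor ℝ 3 3 3)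

/-- item stmt-MatrixMultiplication-5589 · assembly · rank 1 · closed · proved by Summit.MatrixMultiplication.MatrixMultiplication.Theorems.assembly_proof @ 40872d426210 (prover) · by planner
sources: Blaser2013, Razborov1998
[assembly] PolyDepthRefutation → RefutationSound → SuperquadraticGap → ¬MatrixMultiplication. -/
@[route_item "route-MatrixMultiplication-BrentRefutationDepth"]
def Assembly : Prop :=
  PolyDepthRefutation → RefutationSound → SuperquadraticGap → ¬ MatrixMultiplication

/-! D-0027 §2.1 — DECIDING THEOREM (planner-authored via `route open/edit --closes-file`; by planner-rbadge-MatrixMultiplication-BrentRefut-22c5fea8-g2-0 2026-08-15T16:11:59Z):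
its hypotheses are this route's items and its conclusion the sub-problem Statement (glue_lint), and it elaborates with this file. -/

/-- Route glue (D-0027 §2.1, refutation line): the target `PolyDepthRefutation` (for all large `n`
the Brent system `B(n, ⌈n^{2+δ}⌉)` has a Nullstellensatz refutation of polynomial depth), the
soundness of Nullstellensatz refutations for tensor rank (`RefutationSound`: any refutation of
`B(n, r)` gives `r < R(⟨n,n,n⟩)`) and the support item `SuperquadraticGap` (an eventual bound
`n^{2+δ} ≤ R(⟨n,n,n⟩)` contradicts `ω(ℂ) = 2`) refute the summit:
`n^{2+δ} ≤ ⌈n^{2+δ}⌉₊ < R(⟨n,n,n⟩)` for all large `n`. Pure logic plus `Nat.le_ceil`. -/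
@[closes "route-MatrixMultiplication-BrentRefutationDepth"] theorem closes (hX : PolyDepthRefutation) (hS : RefutationSound) (hG : SuperquadraticGap) :
    ¬ MatrixMultiplication := by
  obtain ⟨δ, hδ, C, hev⟩ := hX
  refine hG ⟨δ, hδ, ?_⟩
  filter_upwards [hev] with n hn
  have hlt := hS n ⌈(n : ℝ) ^ (2 + δ)⌉₊ (n ^ C) hn
  calc (n : ℝ) ^ (2 + δ) ≤ (⌈(n : ℝ) ^ (2 + δ)⌉₊ : ℝ) := Nat.le_ceil _
    _ ≤ _ := by exact_mod_cast hlt.le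

end Summit.MatrixMultiplication.MatrixMultiplication.Theses.BrentRefutationDepth
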